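import Literature.NumberTheory.GelbartRogawski1991.LocalDoubledUnitarySplittingDataQuadExt
import Literature.NumberTheory.GelbartRogawski1991.LocalDoubledUnitaryDeltaTransport
import Literature.NumberTheory.GelbartRogawski1991.DoubledUnitarySiegelPlaceComponentsGen
import Literature.NumberTheory.GelbartRogawski1991.DoubledWeilRepresentationArchLagrangianGen
import HarnessLib

/-!
# (GENERAL-`(F, E, c)` TWIN of `DoubledWeilRepresentationLocalFamilyCM` — same statements and proofs over the general doubling
# data of `DoubledUnitaryGlobalSplittingDataGen`: any quadratic extension `E/F`, symmetric invertible `TV`, `TW` over `F`;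
# namespace `GRConstructionGen`; in the prose read `L⁺ := F`, `L := E`, `ε_{L/L⁺} := ε_{E/F}`.)

# The per-place package of the doubled Weil representation at the general dual-pair datum

[GelbartRogawski1991, §3.1 Prop. 3.1.1] by doubling, finite places, for an ARBITRARY quadratic extension `E/F` of number
fields: for the doubled datum `T^𝔻 = T ⊕ (−T)` of `DoubledUnitaryGlobalSplittingDataGen` (`T = T_V ⊗ T_W`, symmetric invertible
`T_V ∈ GL_N(F)`, `T_W ∈ GL_M(F)`) and a Hecke character `χ` of `E` with `χ|_{𝕀_F} = ε_{E/F}`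
(`HarrisKudlaSweet1996.IsSplittingCharExt F E 1 χ`; such `χ` exist for every quadratic `E/F`,
`exists_isUnitary_isSplittingCharExt_one`), the local splitting data `localSplittingDatumQuadExt`
(`LocalDoubledUnitarySplittingDataQuadExt`: Kudla's splitting [Kudla1994, Thm. 3.1] of the doubled unitary group at every finite
place `v` of `F`, split or not, for the local components of `χ⁻¹`) assemble into a `FinLocalFamily χ 𝔪`
(`nonempty_finLocalFamily`): Lagrangian `ℓ_Δ = deltaLagrangian` (carried onto `ℓ_Y` by `δ`, `map_deltaLoc_deltaLagrangian` from
`LocalDoubledUnitaryDeltaTransport`), the local parabolic normalisation from `localSplittingDatumQuadExt_parabolic` through the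
place-component bridges of `DoubledUnitarySiegelPlaceComponentsGen` (`isSiegelDelta_locToAdelic_iff`,
`isUnit_detDelta_locToAdelic_iff`, `chiDet_locToAdelic_eq_prod_dite`, `modDelta_locToAdelic`), and the unramified clause for
almost all `v` (`QuadExt.eventually_isGoodPlace_localComponent_inv`, `localSplittingDatumQuadExt_unramified`).  With the general
twin of `DoubledWeilRepresentationFiniteHalf` this yields the finite half of the doubled Weil representation; nothing is asserted
here.  (GR-1 `pub-hodgecm-own-real34`, §B of the general-`(F, E, σ)` programme; the CM file is untouched.)
-/

set_option autoImplicit false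

noncomputable section

open scoped Classical
open scoped Matrix Kronecker TensorProduct
open NumberField IsDedekindDomain
open Literature.RepresentationTheory.HeisenbergGroup
open Literature.NumberTheory.Automorphic
open Literature.NumberTheory.Weil1964
open Literature.RepresentationTheory.HarrisKudlaSweet1996
open Literature.NumberTheory.GaloisRepresentations

namespace Literature.NumberTheory.GelbartRogawski1991.GRConstructionGen

open UnitaryDualPair

variable (F : Type) [Field F] [NumberField F] (E : Type) [Field E] [NumberField E] [Algebra F E]
  [Algebra.IsQuadraticExtension F E]
variable (c : E ≃ₐ[F] E) {δ : E} (hcδ : c δ = -δ) (hδ : δ ≠ 0) {d : F} (hd : δ * δ = algebraMap F E d)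
variable {N M n : ℕ} (e : Fin N × Fin M ≃ Fin n)
  (TV : Matrix (Fin N) (Fin N) F) (hV : TV.IsSymm) (hVd : IsUnit TV.det)
  (TW : Matrix (Fin M) (Fin M) F) (hW : TW.IsSymm) (hWd : IsUnit TW.det)

section S1finLocal

open Literature.NumberTheory.GelbartRogawski1991.UnitaryDualPair.LocalSplitting hiding IsSiegelDelta chiDet deltaBlock
  detDelta e₂ gramD gramD_isSymm gramS hermD isUnit_det_gramD
open MeasureTheory

omit [NumberField F] [NumberField E] [Algebra.IsQuadraticExtension F E] in
include hV hW in
/-- `T = T_V ⊗ T_W` (the undoubled rational Gram matrix, re-indexed by `e`) is symmetric.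
[cite: GelbartRogawski1991, §3.1 Prop. 3.1.1 p. 455 L1–2] -/
theorem gramR_isSymm : (gramR F e TV TW).IsSymm := by
  show (Matrix.reindex e e _).IsSymm
  exact (UnitaryGroup.isSymm_kronecker hV hW).submatrix _

omit [NumberField F] [NumberField E] [Algebra.IsQuadraticExtension F E] in
/-- `J^𝔻 = T^𝔻 ⊗ E` in the spelling of the local package (`rfl`: the two `gramD`s have the same body).
[cite: GelbartRogawski1991, §3.1 Prop. 3.1.1 p. 455 L1–2] -/
theorem hermD_eq_map_gramD :
    hermD F E e TV TW =
      (Literature.NumberTheory.GelbartRogawski1991.UnitaryDualPair.LocalSplitting.gramD F n (gramR F e TV TW)).map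
        (algebraMap F E) := rfl

omit [NumberField E] [Algebra.IsQuadraticExtension F E] in
/-- **`δ_v ℓ_Δ = ℓ_Y`** at every finite place (`map_transportSp_deltaDiag_deltaLagrangian` at `A := δ ⊗ 1`).
[cite: GelbartRogawski1991, §3.1 Prop. 3.1.1 p. 455 L1–2] -/
theorem map_deltaLoc_deltaLagrangian (v : HeightOneSpectrum (𝓞 F)) :
    (deltaLagrangian F v n).map (toLin F v (deltaLoc F e TV hVd TW hWd v)) = lagrangianY F (n + n) v :=
  map_transportSp_deltaDiag_deltaLagrangian F v n (T₀ := gramR F e TV TW) (isUnit_det_gramR₀ F e TV hVd TW hWd)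
    (isUnit_det_gramDLoc F e TV hVd TW hWd v)
    (SymplecticMatrix.mapHom (algebraMap F (v.adicCompletion F)) (deltaD F)) (by
      rw [SymplecticMatrix.coe_mapHom]
      change (Matrix.reindex _ _ (deltaDiagMatrix F (Fin n))).map _ = _
      rw [Matrix.reindex_apply, Matrix.reindex_apply, ← Matrix.submatrix_map, deltaDiagMatrix_map])

section Family

variable (χ : HeckeCharacter E) (hχ : IsSplittingCharExt F E 1 χ) (𝔪 : ∀ v, PlaceMeasure F v)

/-- **the datum at `v`** (`localSplittingDatumQuadExt`: the split datum at a split place, the non-split one otherwise), in the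
shape `LocalDatumAt` (instances from `𝔪 v`, Lagrangian `ℓ_Δ = deltaLagrangian`).
[cite: GelbartRogawski1991, §3.1 Prop. 3.1.1 p. 455 L1–2] -/
def datumAt (v : HeightOneSpectrum (𝓞 F)) :
    LocalDatumAt F E c hcδ hδ hd e TV hV hVd TW hW hWd v (𝔪 v) (deltaLagrangian F v n)
      (deltaLagrangian_orthogonal F v n (gramR F e TV TW) (isUnit_det_gramR₀ F e TV hVd TW hWd)) := by
  letI := (𝔪 v).mS; haveI := (𝔪 v).isBorel; haveI := (𝔪 v).isHaar
  exact QuadExt.localSplittingDatumQuadExt F E c hcδ hδ hd v (𝔪 v).μ n (T₀ := gramR F e TV TW)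
    (gramR_isSymm F e TV hV TW hW) (isUnit_det_gramR₀ F e TV hVd TW hWd) (JD := hermD F E e TV TW)
    (hermD_eq_map_gramD F E e TV TW) χ hχ

include hχ in
/-- **S1fin-local at general `(F, E, c)`**: the family of local data at the doubled datum — Lagrangian `ℓ_Δ`, datum
`localSplittingDatumQuadExt`, parabolic normalisation (`localSplittingDatumQuadExt_parabolic` + the bridges
`isSiegelDelta_locToAdelic_iff`, `chiDet_locToAdelic_eq_prod_dite`, `modDelta_locToAdelic`), unramified clause
(`QuadExt.eventually_isGoodPlace_localComponent_inv` + `localSplittingDatumQuadExt_unramified`).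
[cite: GelbartRogawski1991, §3.1 Prop. 3.1.1 p. 455 L1–2] -/
theorem nonempty_finLocalFamily : Nonempty (FinLocalFamily F E c hcδ hδ hd e TV hV hVd TW hW hWd χ 𝔪) := by
  classical
  refine ⟨{ ℓ := fun v => deltaLagrangian F v n
            hℓ := fun v => deltaLagrangian_orthogonal F v n (gramR F e TV TW) (isUnit_det_gramR₀ F e TV hVd TW hWd)
            𝓓 := fun v => datumAt F E c hcδ hδ hd e TV hV hVd TW hW hWd χ hχ 𝔪 v
            parabolicNormalised := fun v => ?_
            unramified := ?_ }⟩
  · letI := (𝔪 v).mS; haveI := (𝔪 v).isBorel; haveI := (𝔪 v).isHaar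
    intro p hS hu Φ
    have hloc := (isUnit_detDelta_locToAdelic_iff F E c e TV TW v p).1 hu
    have hp : Literature.NumberTheory.GelbartRogawski1991.UnitaryDualPair.LocalSplitting.IsSiegelDelta F E c hcδ hδ hd v n
        (gramR_isSymm F e TV hV TW hW) (hermD_eq_map_gramD F E e TV TW) p :=
      (isSiegelDelta_iff F E c hcδ hδ hd v n (gramR_isSymm F e TV hV TW hW) (hermD_eq_map_gramD F E e TV TW) p).2
        fun w => (isSiegelDelta_locToAdelic_iff F E c e TV TW v p).1 hS w
    have h8 := QuadExt.localSplittingDatumQuadExt_parabolic F E c hcδ hδ hd v (𝔪 v).μ n (gramR_isSymm F e TV hV TW hW)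
      (isUnit_det_gramR₀ F e TV hVd TW hWd) (hermD_eq_map_gramD F E e TV TW) χ hχ
      (deltaLoc F e TV hVd TW hWd v) (map_deltaLoc_deltaLagrangian F e TV hVd TW hWd v) p hp Φ
    have hX := chiDet_inv F E c v n (fun w' : UnitaryGroup.PlacesOver E v => χ.localComponent w'.1) p
    rw [hX, inv_inv] at h8
    rw [chiDet_locToAdelic_eq_prod_dite F E c e TV TW v χ p hloc, modDelta_locToAdelic F E c e TV TW v p hloc]
    exact h8
  · exact (QuadExt.eventually_isGoodPlace_localComponent_inv F E hδ n (isUnit_det_gramR₀ F e TV hVd TW hWd) χ).mono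
      fun v hgood => by
        letI := (𝔪 v).mS; haveI := (𝔪 v).isBorel; haveI := (𝔪 v).isHaar
        exact QuadExt.localSplittingDatumQuadExt_unramified F E c hcδ hδ hd v (𝔪 v).μ n (gramR_isSymm F e TV hV TW hW)
          (isUnit_det_gramR₀ F e TV hVd TW hWd) (hermD_eq_map_gramD F E e TV TW) χ hχ hgood

end Family

end S1finLocal

end Literature.NumberTheory.GelbartRogawski1991.GRConstructionGen

end
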